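import Literature.Analysis.FluidPDE.LerayProjector
import Literature.Analysis.FluidPDE.HelmholtzAnnihilator
import Mathlib.Analysis.Normed.Operator.Extend
import HarnessLib

/-!
# Duality with divergence-free test fields: `L²` bounds and the space `L²_σ`

Analysis/FluidPDE support file for the uniqueness theorem of Furioli–Lemarié-Rieusset–Terraneo
(`Literature.Analysis.FluidPDE.kato_unique`, fact `Fluid.IsMildNSSolutionOn.ae_eq_Ico_of_ae_eq_Icc_three` of
`KatoUniqueness`). The tree's mild solutions are defined by *duality with divergence-free test
fields* (`Fluid.IsMildNSSolutionFrom`), so every quantitative statement about a solution slice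
`u(t)` is first obtained as a bound on the pairings `∫ ⟪u(t), φ⟫`, `φ ∈ 𝒱 = C_{c,σ}^∞`. This
file converts such bounds into `L²` membership:

* `Literature.Analysis.FluidPDE.memLp_two_of_forall_abs_integral_inner_le` (**proved**): if `f ∈ L^p(E; E)`,
  `1 < p < ∞`, is weakly divergence free and `|∫ ⟪f, φ⟫| ≤ A ‖φ‖_{L²}` for all `φ ∈ 𝒱`, then
  `f ∈ L²` and `‖f‖_{L²} ≤ A`.

Proof: the functional `φ ↦ ∫⟪f, φ⟫` on `𝒱` (`Literature.Fluid.divFreeTest E`, a subspace of `E → E`)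
is bounded for the `L²` norm, hence extends to the accepted solenoidal space
`Fluid.solenoidalL2 E = closure 𝒱` (Mathlib `LinearMap.extendOfNorm` along the dense map
`𝒱 → L²_σ`) and is represented by some `h ∈ L²_σ` with `‖h‖ ≤ A` (Riesz,
`InnerProductSpace.toDual`); elements of `L²_σ` are weakly divergence free
(`isWeaklyDivFree_of_mem_solenoidalL2`), and `∫⟪h - f, φ⟫ = 0` on `𝒱`, so `h = f` a.e. by the
annihilator lemma in `L² + L^p` of `HelmholtzAnnihilator`. As a by-product we **discharge** the
accepted named fact `Fluid.mem_solenoidalL2_iff` (`LerayProjector.lean`; Temam 1977, Ch. I,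
Thm. 1.4/1.6): `v ∈ L²_σ ↔ v` weakly divergence free (`mem_solenoidalL2_iff_holds`).

## Main definitions

* `Literature.Fluid.divFreeTest E`: the subspace `𝒱` of smooth compactly supported divergence-free
  fields (Constantin–Foias 1988, Ch. 4).
* `Literature.Fluid.divFreeTestToL2 E`, `Literature.Fluid.divFreeTestToSolenoidalL2 E`: the linear maps
  `𝒱 → L²(E; E)` and `𝒱 → L²_σ(E)` (`φ ↦ [φ]`); the range of the first is the span of the
  accepted `Fluid.smoothSolenoidal E` (`range_divFreeTestToL2`), the second has dense range
  (`denseRange_divFreeTestToSolenoidalL2`).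

## Mathlib / tree search

Mathlib (this pin) has the abstract tools (`LinearMap.extendOfNorm`, `InnerProductSpace.toDual`,
`Submodule.starProjection`, `Submodule.topologicalClosure`) and no solenoidal spaces; the tree has
`Fluid.solenoidalL2`, `Fluid.lerayProjector` (`LerayProjector.lean`) with `mem_solenoidalL2_iff`
as a named fact, discharged here.

## References

* R. Temam, *Navier–Stokes Equations. Theory and Numerical Analysis* (North-Holland 1977),
  Ch. I, §1.4, Thm. 1.4, Rem. 1.6, Thm. 1.6 (`L² = H ⊕ H^⊥`, characterisation of `H` on
  `ℝⁿ`). Bib key `Temam1977`.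
* P. Constantin, C. Foias, *Navier–Stokes Equations* (Univ. Chicago Press 1988), Ch. 4 (the
  spaces `𝒱`, `H`). Bib key `ConstantinFoias1988`.
-/

noncomputable section

open MeasureTheory TopologicalSpace Set Function Filter Topology InnerProductSpace
open scoped RealInnerProductSpace ENNReal NNReal

namespace Literature.Analysis.FluidPDE

variable {E : Type*} [NormedAddCommGroup E] [InnerProductSpace ℝ E] [FiniteDimensional ℝ E]
  [MeasurableSpace E] [BorelSpace E]

/-! ### The subspace of smooth compactly supported divergence-free fields -/

omit [MeasurableSpace E] [BorelSpace E] [FiniteDimensional ℝ E] in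
/-- Sums of test functions on `⊤` are test functions. [folklore] -/
theorem _root_.Literature.Analysis.FunctionSpaces.IsTestFunctionOn.add_top {F : Type*} [NormedAddCommGroup F] [NormedSpace ℝ F]
    {φ ψ : E → F} (hφ : FunctionSpaces.IsTestFunctionOn (⊤ : Opens E) φ) (hψ : FunctionSpaces.IsTestFunctionOn (⊤ : Opens E) ψ) :
    FunctionSpaces.IsTestFunctionOn (⊤ : Opens E) (φ + ψ) :=
  ⟨hφ.contDiff.add hψ.contDiff, hφ.hasCompactSupport.add hψ.hasCompactSupport, by simp⟩

omit [MeasurableSpace E] [BorelSpace E] [FiniteDimensional ℝ E] in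
/-- Scalar multiples of test functions on `⊤` are test functions. [folklore] -/
theorem _root_.Literature.Analysis.FunctionSpaces.IsTestFunctionOn.const_smul_top {F : Type*} [NormedAddCommGroup F] [NormedSpace ℝ F]
    {φ : E → F} (hφ : FunctionSpaces.IsTestFunctionOn (⊤ : Opens E) φ) (c : ℝ) :
    FunctionSpaces.IsTestFunctionOn (⊤ : Opens E) (c • φ) :=
  ⟨contDiff_const.smul hφ.contDiff, hφ.hasCompactSupport.smul_left, by simp⟩

variable (E) in
/-- The space `𝒱` of smooth, compactly supported, divergence-free vector fields on `E`, as a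
subspace of `E → E` (Constantin–Foias 1988, Ch. 4, the space `𝒱 = {φ ∈ C_c^∞ : div φ = 0}`;
Temam 1977, Ch. I §1.4, (1.31)). Its image in `L²` is the accepted `Fluid.smoothSolenoidal E`,
whose closed span is the accepted `Fluid.solenoidalL2 E`. [cite: ConstantinFoias1988, Ch. 4 (the space 𝒱)] -/
def divFreeTest : Submodule ℝ (E → E) where
  carrier := {φ | FunctionSpaces.IsTestFunctionOn (⊤ : Opens E) φ ∧ VectorCalculus.IsDivFree φ}
  zero_mem' := ⟨FunctionSpaces.isTestFunctionOn_zero _, fun x => by simp [VectorCalculus.divergence]⟩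
  add_mem' := by
    rintro φ ψ ⟨hφ, hφd⟩ ⟨hψ, hψd⟩
    refine ⟨hφ.add_top hψ, fun x => ?_⟩
    have h := divergence_add_apply (v := φ) (w := ψ) (x := x)
      (hφ.contDiff.differentiable (by simp) x) (hψ.contDiff.differentiable (by simp) x)
    rw [hφd x, hψd x, add_zero] at h
    exact h
  smul_mem' := by
    rintro c φ ⟨hφ, hφd⟩
    refine ⟨hφ.const_smul_top c, fun x => ?_⟩
    have h := divergence_const_smul_apply (v := φ) (x := x)
      (hφ.contDiff.differentiable (by simp) x) c
    rw [hφd x, mul_zero] at h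
    exact h

omit [FiniteDimensional ℝ E] [MeasurableSpace E] [BorelSpace E] in
/-- Membership in `𝒱`. [folklore] -/
theorem mem_divFreeTest {φ : E → E} :
    φ ∈ divFreeTest E ↔ FunctionSpaces.IsTestFunctionOn (⊤ : Opens E) φ ∧ VectorCalculus.IsDivFree φ := Iff.rfl

/-- Elements of `𝒱` are in every `L^p`. [folklore] -/
theorem memLp_of_mem_divFreeTest {φ : E → E} (hφ : φ ∈ divFreeTest E) (p : ℝ≥0∞) :
    MemLp φ p (volume : Measure E) :=
  hφ.1.contDiff.continuous.memLp_of_hasCompactSupport hφ.1.hasCompactSupport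

variable (E) in
/-- The linear map `𝒱 → L²(E; E)`, `φ ↦ [φ]` (Constantin–Foias 1988, Ch. 4). [folklore] -/
def divFreeTestToL2 : divFreeTest E →ₗ[ℝ] Lp E 2 (volume : Measure E) where
  toFun φ := (memLp_of_mem_divFreeTest φ.2 2).toLp (φ : E → E)
  map_add' φ ψ := by
    have h := MemLp.toLp_add (memLp_of_mem_divFreeTest φ.2 2) (memLp_of_mem_divFreeTest ψ.2 2)
    exact h.symm ▸ rfl
  map_smul' c φ := by
    have h := MemLp.toLp_const_smul c (memLp_of_mem_divFreeTest φ.2 2)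
    exact h.symm ▸ rfl

/-- The `L²` class of `φ ∈ 𝒱` has `φ` as a representative. [folklore] -/
theorem coeFn_divFreeTestToL2 (φ : divFreeTest E) :
    ((divFreeTestToL2 E φ : Lp E 2 (volume : Measure E)) : E → E) =ᵐ[volume] (φ : E → E) :=
  MemLp.coeFn_toLp (memLp_of_mem_divFreeTest φ.2 2)

/-- The norm of the `L²` class of `φ ∈ 𝒱` is `‖φ‖_{L²}`. [folklore] -/
theorem norm_divFreeTestToL2 (φ : divFreeTest E) :
    ‖divFreeTestToL2 E φ‖ = (eLpNorm (φ : E → E) 2 (volume : Measure E)).toReal := by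
  rw [Lp.norm_def]
  exact congrArg ENNReal.toReal (eLpNorm_congr_ae (coeFn_divFreeTestToL2 φ))

/-- The range of `𝒱 → L²` is the span of the accepted `smoothSolenoidal E` (indeed that set is
already a subspace). [folklore] -/
theorem range_divFreeTestToL2 :
    LinearMap.range (divFreeTestToL2 E) = Submodule.span ℝ (smoothSolenoidal E) := by
  apply le_antisymm
  · rintro v ⟨φ, rfl⟩
    exact Submodule.subset_span ⟨φ, φ.2.1, φ.2.2, coeFn_divFreeTestToL2 φ⟩
  · rw [Submodule.span_le]
    rintro v ⟨φ, hφ, hφd, hv⟩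
    refine ⟨⟨φ, hφ, hφd⟩, ?_⟩
    exact (Lp.ext_iff.2 ((coeFn_divFreeTestToL2 ⟨φ, hφ, hφd⟩).trans hv.symm))

/-- `L²_σ` is the closure of the range of `𝒱 → L²`. [folklore] -/
theorem solenoidalL2_eq_topologicalClosure_range :
    solenoidalL2 E = (LinearMap.range (divFreeTestToL2 E)).topologicalClosure := by
  rw [range_divFreeTestToL2]

/-- `𝒱 → L²` takes values in `L²_σ`. [folklore] -/
theorem divFreeTestToL2_mem (φ : divFreeTest E) : divFreeTestToL2 E φ ∈ solenoidalL2 E := by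
  rw [solenoidalL2_eq_topologicalClosure_range]
  exact Submodule.le_topologicalClosure _ (LinearMap.mem_range_self _ φ)

variable (E) in
/-- The linear map `𝒱 → L²_σ(E)` (Constantin–Foias 1988, Ch. 4: `H` is the closure of `𝒱`). [folklore] -/
def divFreeTestToSolenoidalL2 : divFreeTest E →ₗ[ℝ] solenoidalL2 E :=
  (divFreeTestToL2 E).codRestrict (solenoidalL2 E) divFreeTestToL2_mem

/-- Unfolding `divFreeTestToSolenoidalL2`. [folklore] -/
@[simp]
theorem coe_divFreeTestToSolenoidalL2 (φ : divFreeTest E) :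
    (divFreeTestToSolenoidalL2 E φ : Lp E 2 (volume : Measure E)) = divFreeTestToL2 E φ := rfl

/-- **`𝒱` is dense in `L²_σ`** (by definition of `L²_σ` as a closure). [folklore] -/
theorem denseRange_divFreeTestToSolenoidalL2 : DenseRange (divFreeTestToSolenoidalL2 E) := by
  rw [denseRange_iff_closure_range]
  have hemb : IsEmbedding (Subtype.val : solenoidalL2 E → Lp E 2 (volume : Measure E)) :=
    IsEmbedding.subtypeVal
  rw [eq_univ_iff_forall]
  intro z
  rw [hemb.closure_eq_preimage_closure_image, mem_preimage]
  have himage : Subtype.val '' range (divFreeTestToSolenoidalL2 E) =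
      (LinearMap.range (divFreeTestToL2 E) : Set (Lp E 2 (volume : Measure E))) := by
    ext v
    constructor
    · rintro ⟨w, ⟨φ, rfl⟩, rfl⟩
      exact ⟨φ, rfl⟩
    · rintro ⟨φ, rfl⟩
      exact ⟨divFreeTestToSolenoidalL2 E φ, ⟨φ, rfl⟩, rfl⟩
  rw [himage, ← Submodule.topologicalClosure_coe, ← solenoidalL2_eq_topologicalClosure_range]
  exact z.2

/-- The `L²` inner product against `φ ∈ 𝒱` is the pairing with the representative:
`⟪v, [φ]⟫ = ∫ ⟪v, φ⟫`. [folklore] -/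
theorem inner_divFreeTestToL2 (v : Lp E 2 (volume : Measure E)) (φ : divFreeTest E) :
    ⟪v, divFreeTestToL2 E φ⟫ = ∫ x, ⟪(v : E → E) x, (φ : E → E) x⟫ := by
  rw [L2.inner_def]
  refine integral_congr_ae ?_
  filter_upwards [coeFn_divFreeTestToL2 φ] with x hx
  rw [hx]

/-! ### `L²_σ` fields are weakly divergence free -/

/-- **Elements of `L²_σ` are weakly divergence free** (`⇒` of the accepted
`Fluid.mem_solenoidalL2_iff`; Temam 1977, Ch. I, Thm. 1.4/1.6): the defining identity
`∫ ⟪v, ∇θ⟫ = 0` holds on `𝒱` (divergence theorem, tree `IsDivFree.isWeaklyDivFree_holds`), is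
linear, and is closed under `L²` limits (`v ↦ ∫⟪v, ∇θ⟫ = ⟪v, [∇θ]⟫` is continuous). [cite: Temam1977, Ch. I Thm. 1.4 and Rem. 1.6] -/
theorem isWeaklyDivFree_of_mem_solenoidalL2 {v : Lp E 2 (volume : Measure E)}
    (hv : v ∈ solenoidalL2 E) : IsWeaklyDivFree (v : E → E) := by
  intro θ hθ
  -- the `L²` class of `∇θ`
  have hgc : Continuous (gradient θ) :=
    (InnerProductSpace.toDual ℝ E).symm.continuous.comp (hθ.contDiff.continuous_fderiv (by simp))
  have hgs : HasCompactSupport (gradient θ) :=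
    (hθ.hasCompactSupport.fderiv (𝕜 := ℝ)).comp_left (g := (InnerProductSpace.toDual ℝ E).symm)
      (map_zero _)
  have hgm : MemLp (gradient θ) 2 (volume : Measure E) := hgc.memLp_of_hasCompactSupport hgs
  set G : Lp E 2 (volume : Measure E) := hgm.toLp (gradient θ) with hG
  have hpair : ∀ w : Lp E 2 (volume : Measure E), ∫ x, ⟪(w : E → E) x, gradient θ x⟫ = ⟪w, G⟫ := by
    intro w
    rw [L2.inner_def]
    refine integral_congr_ae ?_
    filter_upwards [hgm.coeFn_toLp] with x hx
    rw [hx]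
  rw [hpair]
  -- the closed subspace where the pairing vanishes contains the span of `𝒱`
  have hclosed : IsClosed {w : Lp E 2 (volume : Measure E) | ⟪w, G⟫ = 0} :=
    isClosed_eq (continuous_id.inner continuous_const) continuous_const
  have hspan : ∀ w ∈ Submodule.span ℝ (smoothSolenoidal E), ⟪w, G⟫ = 0 := by
    intro w hw
    induction hw using Submodule.span_induction with
    | mem w hw =>
      obtain ⟨φ, hφ, hφd, hwφ⟩ := hw
      rw [← hpair]
      have h1 : ∫ x, ⟪(w : E → E) x, gradient θ x⟫ = ∫ x, ⟪φ x, gradient θ x⟫ := by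
        refine integral_congr_ae ?_
        filter_upwards [hwφ] with x hx
        rw [hx]
      rw [h1]
      exact VectorCalculus.IsDivFree.isWeaklyDivFree_holds hφd (hφ.contDiff.of_le (by exact_mod_cast le_top)) θ hθ
    | zero => exact inner_zero_left _
    | add w₁ w₂ _ _ h₁ h₂ => rw [inner_add_left, h₁, h₂, add_zero]
    | smul c w _ h => rw [real_inner_smul_left, h, mul_zero]
  have hsub : ((Submodule.span ℝ (smoothSolenoidal E)).topologicalClosure : Set _) ⊆
      {w : Lp E 2 (volume : Measure E) | ⟪w, G⟫ = 0} := by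
    rw [Submodule.topologicalClosure_coe]
    exact closure_minimal hspan hclosed
  exact hsub hv


/-! ### `L²` bounds by duality with `𝒱` -/

/-- Weak divergence-freeness is invariant under a.e. modification. [folklore] -/
theorem IsWeaklyDivFree.congr_ae {u v : E → E} (hu : IsWeaklyDivFree u) (huv : u =ᵐ[volume] v) :
    IsWeaklyDivFree v := fun θ hθ => by
  rw [← hu θ hθ]
  refine integral_congr_ae ?_
  filter_upwards [huv] with x hx
  rw [hx]

/-- The difference of two locally integrable weakly divergence-free fields is weakly divergence
free. [folklore] -/
theorem IsWeaklyDivFree.sub_of_locallyIntegrable {u v : E → E} (hu : IsWeaklyDivFree u)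
    (hv : IsWeaklyDivFree v) (hui : LocallyIntegrable u volume) (hvi : LocallyIntegrable v volume) :
    IsWeaklyDivFree (u - v) := by
  intro θ hθ
  have hgc : Continuous (gradient θ) :=
    (InnerProductSpace.toDual ℝ E).symm.continuous.comp (hθ.contDiff.continuous_fderiv (by simp))
  have hgs : HasCompactSupport (gradient θ) :=
    (hθ.hasCompactSupport.fderiv (𝕜 := ℝ)).comp_left (g := (InnerProductSpace.toDual ℝ E).symm)
      (map_zero _)
  have iu := integrable_inner_of_locallyIntegrable_of_hasCompactSupport hui hgc hgs
  have iv := integrable_inner_of_locallyIntegrable_of_hasCompactSupport hvi hgc hgs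
  simp only [Pi.sub_apply, inner_sub_left]
  rw [integral_sub iu iv, hu θ hθ, hv θ hθ, sub_zero]

/-- **`L²` bounds by duality with divergence-free test fields.** Let `f ∈ L^p(E; E)`,
`1 < p < ∞`, be weakly divergence free, and suppose `|∫ ⟪f, φ⟫| ≤ A ‖φ‖_{L²}` for every smooth
compactly supported divergence-free `φ`. Then `f ∈ L²` with `‖f‖_{L²} ≤ A`. Proof: the bounded
functional `φ ↦ ∫⟪f, φ⟫` on `𝒱` extends to `L²_σ = closure 𝒱` (Mathlib
`LinearMap.extendOfNorm`) and is represented by some `h ∈ L²_σ`, `‖h‖ ≤ A` (Riesz); `h` is weakly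
divergence free (`isWeaklyDivFree_of_mem_solenoidalL2`) and `∫⟪h - f, φ⟫ = 0` on `𝒱`, so
`h - f = 0` a.e. by the annihilator lemma in `L² + L^p`
(`IsWeaklyDivFree.ae_eq_zero_of_add_memLp_of_forall_integral_inner_eq_zero`). This is how the
duality formulation of mild solutions sees the `L²` norm of a divergence-free field: only through
solenoidal tests (Temam 1977, Ch. I, Thm. 1.4 and Rem. 1.6: `L² = H ⊕ H^⊥` with `H^⊥` the
gradients, which a divergence-free field does not see). [cite: Temam1977, Ch. I Thm. 1.4 and Rem. 1.6] -/
theorem memLp_two_of_forall_abs_integral_inner_le {p : ℝ≥0∞} (hp : 1 < p) (hp' : p < (⊤ : ℝ≥0∞))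
    {f : E → E} (hf : MemLp f p (volume : Measure E)) (hdiv : IsWeaklyDivFree f) {A : ℝ}
    (hA : 0 ≤ A)
    (hbd : ∀ φ : E → E, FunctionSpaces.IsTestFunctionOn (⊤ : Opens E) φ → VectorCalculus.IsDivFree φ →
      |∫ x, ⟪f x, φ x⟫| ≤ A * (eLpNorm φ 2 (volume : Measure E)).toReal) :
    MemLp f 2 (volume : Measure E) ∧ eLpNorm f 2 (volume : Measure E) ≤ ENNReal.ofReal A := by
  have hfl : LocallyIntegrable f volume := hf.locallyIntegrable hp.le
  have hint : ∀ φ : divFreeTest E, Integrable (fun x => ⟪f x, (φ : E → E) x⟫) volume := fun φ =>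
    integrable_inner_of_locallyIntegrable_of_hasCompactSupport hfl φ.2.1.contDiff.continuous
      φ.2.1.hasCompactSupport
  -- the functional `ℓ(φ) = ∫⟪f, φ⟫` on `𝒱`
  set ℓ : divFreeTest E →ₗ[ℝ] ℝ :=
    { toFun := fun φ => ∫ x, ⟪f x, (φ : E → E) x⟫
      map_add' := fun φ ψ => by
        simp only [Submodule.coe_add, Pi.add_apply, inner_add_right]
        exact integral_add (hint φ) (hint ψ)
      map_smul' := fun c φ => by
        simp only [Submodule.coe_smul, Pi.smul_apply, real_inner_smul_right, RingHom.id_apply,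
          smul_eq_mul]
        exact integral_const_mul _ _ } with hℓ_def
  have hℓ : ∀ φ : divFreeTest E, ‖ℓ φ‖ ≤ A * ‖divFreeTestToSolenoidalL2 E φ‖ := fun φ => by
    rw [Real.norm_eq_abs, Submodule.coe_norm, coe_divFreeTestToSolenoidalL2, norm_divFreeTestToL2]
    exact hbd φ φ.2.1 φ.2.2
  have hdense := denseRange_divFreeTestToSolenoidalL2 (E := E)
  -- extension to `L²_σ` and Riesz representation
  set L : solenoidalL2 E →L[ℝ] ℝ := ℓ.extendOfNorm (divFreeTestToSolenoidalL2 E) with hL_def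
  have hL_eq : ∀ φ : divFreeTest E, L (divFreeTestToSolenoidalL2 E φ) = ℓ φ := fun φ =>
    LinearMap.extendOfNorm_eq hdense ⟨A, hℓ⟩ φ
  have hL_norm : ‖L‖ ≤ A := LinearMap.opNorm_extendOfNorm_le hdense hA hℓ
  set h : solenoidalL2 E := (InnerProductSpace.toDual ℝ (solenoidalL2 E)).symm L with hh_def
  have hh_inner : ∀ y : solenoidalL2 E, ⟪h, y⟫ = L y := fun y =>
    InnerProductSpace.toDual_symm_apply
  have hh_norm : ‖h‖ ≤ A := by
    rw [hh_def, LinearIsometryEquiv.norm_map]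
    exact hL_norm
  -- the representative of `h`
  set g : E → E := ((h : Lp E 2 (volume : Measure E)) : E → E) with hg_def
  have hgm : MemLp g 2 (volume : Measure E) := Lp.memLp _
  have hgdiv : IsWeaklyDivFree g := isWeaklyDivFree_of_mem_solenoidalL2 h.2
  have hg_pair : ∀ φ : divFreeTest E, ∫ x, ⟪g x, (φ : E → E) x⟫ = ∫ x, ⟪f x, (φ : E → E) x⟫ :=
    fun φ => by
    rw [← inner_divFreeTestToL2, ← coe_divFreeTestToSolenoidalL2, ← Submodule.coe_inner, hh_inner,
      hL_eq]
    rfl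
  -- `g - f` is annihilated by `𝒱`, weakly divergence free, in `L² + L^p`: zero a.e.
  have horth : ∀ φ : E → E, FunctionSpaces.IsTestFunctionOn (⊤ : Opens E) φ → VectorCalculus.IsDivFree φ →
      ∫ x, ⟪(g + -f) x, φ x⟫ = 0 := fun φ hφ hφd => by
    have ig : Integrable (fun x => ⟪g x, φ x⟫) volume :=
      integrable_inner_of_locallyIntegrable_of_hasCompactSupport (hgm.locallyIntegrable one_le_two)
        hφ.contDiff.continuous hφ.hasCompactSupport
    simp only [Pi.add_apply, Pi.neg_apply, inner_add_left, inner_neg_left]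
    have i2 : Integrable (fun x => -⟪f x, φ x⟫) volume := (hint ⟨φ, hφ, hφd⟩).neg
    rw [integral_add ig i2, integral_neg]
    have hp := hg_pair ⟨φ, hφ, hφd⟩
    simp only at hp
    rw [hp]
    exact add_neg_cancel _
  have hsum : IsWeaklyDivFree (g + -f) := by
    have h1 := hgdiv.sub_of_locallyIntegrable hdiv (hgm.locallyIntegrable one_le_two) hfl
    rwa [sub_eq_add_neg] at h1
  have hae := IsWeaklyDivFree.ae_eq_zero_of_add_memLp_of_forall_integral_inner_eq_zero
    (w₁ := g) (w₂ := -f) ENNReal.one_lt_two ENNReal.ofNat_lt_top hp hp' hgm hf.neg hsum horth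
  have hfg : f =ᵐ[volume] g := by
    filter_upwards [hae] with x hx
    have hx' : g x + -f x = 0 := hx
    rw [← sub_eq_add_neg, sub_eq_zero] at hx'
    exact hx'.symm
  refine ⟨hgm.ae_eq hfg.symm, ?_⟩
  rw [eLpNorm_congr_ae hfg, hg_def, ← Lp.enorm_def, ← ofReal_norm]
  exact ENNReal.ofReal_le_ofReal (by simpa [Submodule.coe_norm] using hh_norm)


/-! ### Discharge of `Fluid.mem_solenoidalL2_iff` -/

/-- **Discharge** of the accepted `Fluid.mem_solenoidalL2_iff` (Temam 1977, Ch. I, Thm. 1.4 with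
Rem. 1.6 / Thm. 1.6 for `Ω = ℝⁿ`): an `L²` field lies in `L²_σ` iff it is weakly divergence
free. `⇒` is `isWeaklyDivFree_of_mem_solenoidalL2`; for `⇐`, `v - Pv` (`P` the Leray projector)
is orthogonal to `L²_σ`, hence annihilates `𝒱`, and is weakly divergence free, so it vanishes by
the annihilator lemma (`IsWeaklyDivFree.ae_eq_zero_of_memLp_of_forall_integral_inner_eq_zero`,
`p = 2`) and `v = Pv ∈ L²_σ`. [cite: Temam1977, Ch. I Thm. 1.4 with Rem. 1.6 / Thm. 1.6] -/
theorem mem_solenoidalL2_iff_holds : mem_solenoidalL2_iff (E := E) := by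
  intro v
  refine ⟨isWeaklyDivFree_of_mem_solenoidalL2, fun hv => ?_⟩
  set w : Lp E 2 (volume : Measure E) := v - lerayProjector E v with hw_def
  have hwo : w ∈ (solenoidalL2 E)ᗮ := Submodule.sub_starProjection_mem_orthogonal v
  have hPw : IsWeaklyDivFree ((lerayProjector E v : Lp E 2 (volume : Measure E)) : E → E) :=
    isWeaklyDivFree_of_mem_solenoidalL2 (lerayProjector_apply_mem v)
  -- the representative of `w` is weakly divergence free and annihilates `𝒱`
  have hwdiv : IsWeaklyDivFree ((w : Lp E 2 (volume : Measure E)) : E → E) := by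
    have h1 := hv.sub_of_locallyIntegrable hPw ((Lp.memLp v).locallyIntegrable one_le_two)
      ((Lp.memLp _).locallyIntegrable one_le_two)
    exact h1.congr_ae (Lp.coeFn_sub _ _).symm
  have hworth : ∀ φ : E → E, FunctionSpaces.IsTestFunctionOn (⊤ : Opens E) φ → VectorCalculus.IsDivFree φ →
      ∫ x, ⟪(w : E → E) x, φ x⟫ = 0 := fun φ hφ hφd => by
    rw [← inner_divFreeTestToL2 w ⟨φ, hφ, hφd⟩]
    exact Submodule.inner_left_of_mem_orthogonal (divFreeTestToL2_mem ⟨φ, hφ, hφd⟩) hwo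
  have hae := IsWeaklyDivFree.ae_eq_zero_of_memLp_of_forall_integral_inner_eq_zero
    ENNReal.one_lt_two ENNReal.ofNat_lt_top (Lp.memLp w) hwdiv hworth
  have hw0 : w = 0 := (Lp.eq_zero_iff_ae_eq_zero).2 hae
  rw [hw_def, sub_eq_zero] at hw0
  rw [hw0]
  exact lerayProjector_apply_mem v


end Literature.Analysis.FluidPDE
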